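import Summits.HodgeConjecture.HodgeConjecture.Theorems.Ring2WeilCoverageCMFieldAllPrimesH
import Summits.HodgeConjecture.HodgeConjecture.Theorems.Ring2WeilCoverageCMFieldNonGalois
import HarnessLib

/-!
# Weil-type components over quartic CM fields, IX (part O): the non-Galois field `ℚ(√-(3+√2))` —
# the BOTH-INERT primes with `ℓ` variable, and the NECESSARY half of the prime classification for every prime

research route conditional on HC_CM; not a corollary; Q11.4-sentence-2 already refuted in dim ≥ 3. Cell
`pub-hodge-ring2`, seat `ring2-b03` (gen 53); complement to parts C and H and to `Ring2WeilCoverageCMFieldNonGalois`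
for the `D₄` census field `E = ℚ(√-(3+√2))`, `F = ℚ(√2)`, `σ = -3-√2`, `Nm σ = 7`, `R = S² + 6S + 7`
(`HOME/WEIL-FAMILY-COVERAGE.md` §b03.5, seventh table). Part H left exactly one obstruction type outside every
variable-`ℓ` theorem: `ℓ ≡ ±1 (mod 8)` (split in `F`), `(7/ℓ) = (ℓ/7) = +1`, and BOTH places of `F` over `ℓ`
inert in `E/F` — «not a congruence condition». It is, however, the explicit Frobenius condition
«`T⁴ + 6T² + 7` (the minimal polynomial of `η = √σ`) has NO root mod `ℓ`»: a place `(π)` of `F` over `ℓ` with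
`σ ≡ -t (mod π)` splits in `E` iff `-t` is a square mod `ℓ`, and a square root `e` of `-t` is a root of the
quartic (`(e² + 3)² = (3 - t)² = (t² - 6t + 7) + 2 ≡ 2`). Hence:

* §1 **`[ℓw] ≠ [1]` for every prime `ℓ ≡ ±1 (mod 8)` at which `T⁴ + 6T² + 7` has no root, `ℓ ∤ w`** — part H's
  generator `π = x + y√2` from Thue's lemma, Bezout, and the gen-50 degree-one engine at `π` itself (no case
  split: `-t` is a non-square BECAUSE a square root would be a root of the quartic); numeral: `ℓ = 113`
  (`113 ≡ 1 (mod 8)`, `113 ≡ 1 (mod 7)`: the first prime obstructed ONLY by this condition; `decide` over `𝔽₁₁₃`).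
* §2 **The necessary half of the classification, EVERY prime `ℓ`:** if `[ℓ] = [1]` then
  `ℓ = 2`, or `ℓ ≡ 5 (mod 8)` and `ℓ ≡ 1, 2, 4 (mod 7)`, or `ℓ ≡ 1 (mod 8)`, `ℓ ≡ 1, 2, 4 (mod 7)` and the quartic
  has a root mod `ℓ` (assembled from part C, part H, §1, and the tame place `(σ)` of norm `7`:
  `…_of_residue`, `…_mk_seven_mul_ne…`); in particular **`[ℓ] ≠ [1]` for every prime `ℓ ≡ 3 (mod 4)`**.
* §3 The three split types are inhabited beyond the census window `n ≤ 40`: `[53] = [109] = [1]` (`ℓ ≡ 5 (8)`),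
  **`[137] = [193] = [1]`** (the first two primes of the third type, `ℓ ≡ 1 (8)`), by integer norm witnesses;
  and `[149] = [197] = [1]`.
* §4 Literal packaging (`R = S² + 6S + 7` verbatim, the `Fact` discharged).

The converse half (every prime of one of the three types IS split) is known here by numerals only
(`2, 29, 37` of `Ring2WeilCoverageCMFieldNormWitnessesB`, and §3).
No named fact, no definition, no `sorry`; nothing about the Hodge conjecture is asserted.
References: [Deligne1982HodgeCycles] §4 p. 30 (1), Cor. 4.2, Lemma 4.6; [Landherr1936HermitianForms]. -/

noncomputable section

set_option linter.dupNamespace false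

open Polynomial

namespace Summit.HodgeConjecture.HodgeConjecture.Ring2.WeilCoverageCM

open Literature.AlgebraicGeometry.Deligne1982
open Literature.AlgebraicGeometry.HodgeTheory (splitDiscriminantClassCM)

set_option maxRecDepth 20000 in
/-- `T⁴ + 6T² + 7` has no root mod `113` (`113 ≡ 1 (mod 8)`, `113 ≡ 1 (mod 7)`; both places of `ℚ(√2)` over `113`
are inert in `ℚ(√-(3+√2))`): 113 cases. [folklore] -/
theorem no_root_quartic_six_seven_mod_113 : ∀ e : ZMod 113, e ^ 4 + 6 * e ^ 2 + 7 ≠ 0 := by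
  decide

/-! ### §1 `E = ℚ(√-(3+√2))`: the both-inert primes, `ℓ` variable -/

section SqrtNegThreePlusSqrtTwo

variable {R : Polynomial ℤ} (hR : R = X ^ 2 + C 6 * X + C 7) [Fact (Irreducible (realPolyQ R))]
include hR

/-- **`[ℓw] ≠ [1]` for the non-Galois field `E = ℚ(√-(3+√2))` and EVERY prime `ℓ ≡ ±1 (mod 8)` at which
`T⁴ + 6T² + 7` has no root, `ℓ ∤ w`.** `π = x + y√2 = (x - 3y) - yσ` with `Nm π = x² - 2y² = ℓ` from Thue; `γ` from
Bezout (`πγ = t + σ`); `ℓ ∣ t² - 6t + 7`; a square root `e` of `-t` mod `ℓ` would satisfy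
`e⁴ + 6e² + 7 = (e² + 3)² - 2 = (t - 3)² - 2 ≡ 0`, so `-t` (the image of `σ` at `(π)`) is a non-square: `(π)` is INERT
in `E/F` and the gen-50 engine applies at `π`. Census rows `[113]`, `[233]`, `[281]`, `[337]`, … (`ℓ ≡ 1 (8)`,
`(ℓ/7) = 1`, no root) — the one obstruction type of the `D₄` table that is not a congruence class.
[cite: Deligne1982HodgeCycles, §4 p. 30 (1) and Cor. 4.2] [cite: Landherr1936HermitianForms] -/
theorem sqrtNegThreePlusSqrtTwo_mk_prime_mul_ne_splitDiscriminantClassCM_of_noRoot (ℓ : ℕ) (hℓ : ℓ.Prime)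
    (h8 : ℓ % 8 = 1 ∨ ℓ % 8 = 7) (hno : ∀ e : ZMod ℓ, e ^ 4 + 6 * e ^ 2 + 7 ≠ 0)
    (w : ℤ) (hw : ¬ (ℓ : ℤ) ∣ w) (u : (realField R)ˣ)
    (hu : (u : realField R) = AdjoinRoot.of (realPolyQ R) (ℓ * w)) :
    (QuotientGroup.mk u : cmNormResidueGroup R) ≠ splitDiscriminantClassCM R 2 := by
  haveI : Fact ℓ.Prime := ⟨hℓ⟩
  have hℓp : Prime (ℓ : ℤ) := Nat.prime_iff_prime_int.1 hℓ
  have hℓ0 : (ℓ : ℤ) ≠ 0 := by exact_mod_cast hℓ.ne_zero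
  have h2 : ℓ ≠ 2 := by omega
  have h2' : (2 : ZMod ℓ) ≠ 0 := by exact_mod_cast natCast_prime_ne_zero_zmod Nat.prime_two h2
  obtain ⟨r, hr⟩ := (ZMod.exists_sq_eq_two_iff h2).2 (by omega)
  obtain ⟨x, y, hxy, -⟩ := exists_sq_sub_two_mul_sq_eq_prime (ℓ := ℓ) r (by rw [sq, ← hr])
  -- `ℓ ∤ y`, and `gcd(y, x) = 1`
  have hy : ¬ (ℓ : ℤ) ∣ y := by
    rintro ⟨b, hb⟩
    have hx : (ℓ : ℤ) ∣ x ^ 2 := by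
      refine ⟨1 + 2 * ℓ * b ^ 2, ?_⟩
      rw [hb] at hxy
      linear_combination hxy
    obtain ⟨a, ha⟩ := hℓp.dvd_of_dvd_pow hx
    have e : (ℓ : ℤ) * (ℓ * (a ^ 2 - 2 * b ^ 2) - 1) = 0 := by
      rw [ha, hb] at hxy
      linear_combination hxy
    have e' : (ℓ : ℤ) * (a ^ 2 - 2 * b ^ 2) - 1 = 0 := (mul_eq_zero.1 e).resolve_left hℓ0
    have h1 : (ℓ : ℤ) ∣ 1 := by
      refine ⟨a ^ 2 - 2 * b ^ 2, ?_⟩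
      linear_combination -e'
    exact hℓ.not_dvd_one (by exact_mod_cast h1)
  have hcop : IsCoprime y x := by
    rw [Int.isCoprime_iff_gcd_eq_one]
    obtain ⟨g, hg⟩ : ∃ g : ℤ, g = ((Int.gcd y x : ℕ) : ℤ) := ⟨_, rfl⟩
    have hd1 : g ∣ y := by rw [hg]; exact Int.gcd_dvd_left y x
    have hd2 : g ∣ x := by rw [hg]; exact Int.gcd_dvd_right y x
    have hdl : g ∣ (ℓ : ℤ) := by
      obtain ⟨c, hc⟩ := hd1
      obtain ⟨d, hd⟩ := hd2
      refine ⟨g * (d ^ 2 - 2 * c ^ 2), ?_⟩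
      rw [← hxy, hc, hd]; ring
    rw [hg] at hdl hd1
    have hdl' : Int.gcd y x ∣ ℓ := by exact_mod_cast hdl
    rcases (Nat.dvd_prime hℓ).1 hdl' with h | h
    · exact h
    · exfalso; rw [h] at hd1; exact hy hd1
  have hcop' : IsCoprime (-y) (x + 3 * y) := by
    have h1 := (hcop.neg_left).add_mul_right_right (-3)
    have e : x + -3 * -y = x + 3 * y := by ring
    rwa [e] at h1
  obtain ⟨g₀, g₁, hbez⟩ := hcop'
  -- `π = u₀ + v₀σ` with `u₀ = x - 3y`, `v₀ = -y`; `γ = g₀ + g₁σ`; `t`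
  obtain ⟨u₀, hu₀⟩ : ∃ u₀ : ℤ, u₀ = x - 3 * y := ⟨_, rfl⟩
  obtain ⟨v₀, hv₀⟩ : ∃ v₀ : ℤ, v₀ = -y := ⟨_, rfl⟩
  obtain ⟨t, ht⟩ : ∃ t : ℤ, u₀ * g₀ - 7 * v₀ * g₁ = t := ⟨_, rfl⟩
  have hnorm : u₀ ^ 2 - 6 * u₀ * v₀ + 7 * v₀ ^ 2 = (ℓ : ℤ) := by rw [hu₀, hv₀]; linear_combination hxy
  have hγ : v₀ * g₀ + u₀ * g₁ - 6 * v₀ * g₁ = 1 := by rw [hu₀, hv₀]; linear_combination hbez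
  have hL : (u₀ ^ 2 - 6 * u₀ * v₀ + 7 * v₀ ^ 2).natAbs = ℓ := by rw [hnorm]; exact Int.natAbs_natCast ℓ
  have hv : ¬ (ℓ : ℤ) ∣ v₀ := by rw [hv₀]; exact fun h => hy (dvd_neg.1 h)
  -- `t² - 6t + 7 ≡ 0 (mod ℓ)`: the norm form is multiplicative, `Nm(π)·Nm(γ) = Nm(t + σ)`
  have hroot : ((t : ZMod ℓ)) ^ 2 - 6 * t + 7 = 0 := by
    have e : (u₀ ^ 2 - 6 * u₀ * v₀ + 7 * v₀ ^ 2) * (g₀ ^ 2 - 6 * g₀ * g₁ + 7 * g₁ ^ 2) = t ^ 2 - 6 * t + 7 := by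
      rw [← ht]
      linear_combination (-6 * (u₀ * g₀ - 7 * v₀ * g₁) + 7 * ((v₀ * g₀ + u₀ * g₁ - 6 * v₀ * g₁) + 1)) * hγ
    rw [hnorm] at e
    have := congrArg (Int.cast : ℤ → ZMod ℓ) e
    push_cast at this
    rw [ZMod.natCast_self, zero_mul] at this
    linear_combination -this
  have h2t : ¬ (ℓ : ℤ) ∣ 2 * t - 6 := by
    rw [← ZMod.intCast_zmod_eq_zero_iff_dvd]
    push_cast
    intro h
    have ht3 : (t : ZMod ℓ) = 3 := by
      have : (2 : ZMod ℓ) * ((t : ZMod ℓ) - 3) = 0 := by linear_combination h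
      exact sub_eq_zero.1 ((mul_eq_zero.1 this).resolve_left h2')
    rw [ht3] at hroot
    exact h2' (by linear_combination -hroot)
  -- `-t` is a non-square: a square root would be a root of `T⁴ + 6T² + 7`
  have hns : ∀ s : ZMod ℓ, s ^ 2 ≠ -(t : ZMod ℓ) := by
    intro s hs
    apply hno s
    linear_combination (s ^ 2 - (t : ZMod ℓ) + 6) * hs + hroot
  exact mk_norm_mul_ne_splitDiscriminantClassCM_of_inert_general hR (by norm_num) (by norm_num)
    disc_not_sq_six_seven u₀ v₀ g₀ g₁ t ℓ hℓ hL ht hγ hns h2t hv w hw u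
    (by rw [hu, hnorm]; push_cast; ring)

/-- **`[ℓ] ≠ [1]` for `E = ℚ(√-(3+√2))` and every prime `ℓ ≡ ±1 (mod 8)` at which `T⁴ + 6T² + 7` has no root**
(both places of `F = ℚ(√2)` over `ℓ` inert in `E/F`). [cite: Deligne1982HodgeCycles, §4 p. 30 (1) and Cor. 4.2] -/
theorem sqrtNegThreePlusSqrtTwo_mk_prime_ne_splitDiscriminantClassCM_of_noRoot (ℓ : ℕ) (hℓ : ℓ.Prime)
    (h8 : ℓ % 8 = 1 ∨ ℓ % 8 = 7) (hno : ∀ e : ZMod ℓ, e ^ 4 + 6 * e ^ 2 + 7 ≠ 0)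
    (u : (realField R)ˣ) (hu : (u : realField R) = ℓ) :
    (QuotientGroup.mk u : cmNormResidueGroup R) ≠ splitDiscriminantClassCM R 2 :=
  sqrtNegThreePlusSqrtTwo_mk_prime_mul_ne_splitDiscriminantClassCM_of_noRoot hR ℓ hℓ h8 hno 1
    (by exact_mod_cast hℓ.not_dvd_one) u
    (by rw [hu, Int.cast_one, mul_one]; exact (map_natCast (AdjoinRoot.of (realPolyQ R)) ℓ).symm)

/-- **`[113w] ≠ [1]` for `E = ℚ(√-(3+√2))`, `113 ∤ w`**: the FIRST prime of the `D₄` table obstructed only by the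
Frobenius condition (`113 ≡ 1 (mod 8)` splits in `F`, `(7/113) = (113/7) = +1`, yet both places over `113` are inert in
`E/F`: `T⁴ + 6T² + 7` has no root mod `113`). [cite: Deligne1982HodgeCycles, §4 p. 30 (1) and Cor. 4.2]
[cite: Landherr1936HermitianForms] -/
theorem sqrtNegThreePlusSqrtTwo_mk_113_mul_ne_splitDiscriminantClassCM (w : ℤ) (hw : ¬ (113 : ℤ) ∣ w)
    (u : (realField R)ˣ) (hu : (u : realField R) = AdjoinRoot.of (realPolyQ R) (113 * w)) :
    (QuotientGroup.mk u : cmNormResidueGroup R) ≠ splitDiscriminantClassCM R 2 :=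
  sqrtNegThreePlusSqrtTwo_mk_prime_mul_ne_splitDiscriminantClassCM_of_noRoot hR 113 (by norm_num)
    (Or.inl rfl) no_root_quartic_six_seven_mod_113 w (by exact_mod_cast hw) u (by rw [hu]; push_cast; ring_nf)

/-! ### §2 The necessary half of the prime classification of the `D₄` table, every prime -/

/-- **If `[ℓ] = [1]` for a prime `ℓ` (`E = ℚ(√-(3+√2))`), then `ℓ` is of one of the three SPLIT TYPES**:
`ℓ = 2`; or `ℓ ≡ 5 (mod 8)` (inert in `F`) and `ℓ ≡ 1, 2, 4 (mod 7)`; or `ℓ ≡ 1 (mod 8)`, `ℓ ≡ 1, 2, 4 (mod 7)` and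
`T⁴ + 6T² + 7` has a root mod `ℓ`. Assembly: `ℓ = 7` and `ℓ ≡ 3, 5, 6 (mod 7)` by the tame ramified place `(σ)`
(`Ring2WeilCoverageCMFieldNonGalois`); for `ℓ ≡ 1, 2, 4 (mod 7)`: `ℓ ≡ 3 (8)` is `ℓ mod 56 ∈ {11, 43, 51}` (part C,
inert in `F` and in `E/F`), `ℓ ≡ 7 (8)` is `ℓ mod 56 ∈ {15, 23, 39}` (part H, half-split), `ℓ ≡ 1 (8)` without a root
is §1. [cite: Deligne1982HodgeCycles, §4 p. 30 (1) and Cor. 4.2] [cite: Landherr1936HermitianForms] -/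
theorem sqrtNegThreePlusSqrtTwo_splitType_of_mk_prime_eq_splitDiscriminantClassCM (ℓ : ℕ) (hℓ : ℓ.Prime)
    (u : (realField R)ˣ) (hu : (u : realField R) = ℓ)
    (h : (QuotientGroup.mk u : cmNormResidueGroup R) = splitDiscriminantClassCM R 2) :
    ℓ = 2 ∨ (ℓ % 8 = 5 ∧ (ℓ % 7 = 1 ∨ ℓ % 7 = 2 ∨ ℓ % 7 = 4)) ∨
      (ℓ % 8 = 1 ∧ (ℓ % 7 = 1 ∨ ℓ % 7 = 2 ∨ ℓ % 7 = 4) ∧ ∃ e : ZMod ℓ, e ^ 4 + 6 * e ^ 2 + 7 = 0) := by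
  by_cases h2 : ℓ = 2
  · exact Or.inl h2
  have hodd : ℓ % 2 = 1 := Nat.odd_iff.1 (hℓ.odd_of_ne_two h2)
  have huZ : (u : realField R) = AdjoinRoot.of (realPolyQ R) ((ℓ : ℤ) : ℚ) := by
    rw [hu, Int.cast_natCast, map_natCast]
  -- `ℓ = 7`
  by_cases h7 : ℓ = 7
  · subst h7
    exact absurd h (sqrtNegThreePlusSqrtTwo_mk_seven_mul_ne_splitDiscriminantClassCM hR 1 (Or.inl (by simp)) u
      (by rw [huZ]; norm_num))
  have h7' : ℓ % 7 ≠ 0 := by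
    intro h0
    have hd : 7 ∣ ℓ := Nat.dvd_of_mod_eq_zero h0
    rcases (Nat.dvd_prime hℓ).1 hd with h1 | h1
    · norm_num at h1
    · exact h7 h1.symm
  -- `ℓ ≡ 3, 5, 6 (mod 7)`: the tame ramified place
  have hcast7 : ((ℓ : ℤ) : ZMod 7) = ((ℓ % 7 : ℕ) : ZMod 7) := by
    rw [Int.cast_natCast, ZMod.natCast_mod]
  by_cases hres : ℓ % 7 = 3 ∨ ℓ % 7 = 5 ∨ ℓ % 7 = 6
  · refine absurd h (sqrtNegThreePlusSqrtTwo_mk_ne_splitDiscriminantClassCM_of_residue hR (ℓ : ℤ) ?_ u huZ)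
    rw [hcast7]
    rcases hres with h3 | h5 | h6
    · rw [h3]; exact Or.inl rfl
    · rw [h5]; exact Or.inr (Or.inl rfl)
    · rw [h6]; exact Or.inr (Or.inr rfl)
  have hsq7 : ℓ % 7 = 1 ∨ ℓ % 7 = 2 ∨ ℓ % 7 = 4 := by omega
  -- by `ℓ mod 8`
  have h8 : ℓ % 8 = 1 ∨ ℓ % 8 = 3 ∨ ℓ % 8 = 5 ∨ ℓ % 8 = 7 := by omega
  rcases h8 with h81 | h83 | h85 | h87
  · -- `ℓ ≡ 1 (8)`: a root, or §1
    by_cases hroot : ∃ e : ZMod ℓ, e ^ 4 + 6 * e ^ 2 + 7 = 0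
    · exact Or.inr (Or.inr ⟨h81, hsq7, hroot⟩)
    · push Not at hroot
      exact absurd h (sqrtNegThreePlusSqrtTwo_mk_prime_ne_splitDiscriminantClassCM_of_noRoot hR ℓ hℓ
        (Or.inl h81) hroot u hu)
  · -- `ℓ ≡ 3 (8)`, `ℓ ≡ 1, 2, 4 (7)`: `ℓ mod 56 ∈ {43, 51, 11}` — part C
    have h56 : ℓ % 56 = 5 ∨ ℓ % 56 = 11 ∨ ℓ % 56 = 13 ∨ ℓ % 56 = 43 ∨ ℓ % 56 = 45 ∨ ℓ % 56 = 51 := by omega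
    exact absurd h (sqrtNegThreePlusSqrtTwo_mk_prime_ne_splitDiscriminantClassCM_of_mod_fiftySix hR ℓ hℓ h56 u hu)
  · exact Or.inr (Or.inl ⟨h85, hsq7⟩)
  · -- `ℓ ≡ 7 (8)`, `ℓ ≡ 1, 2, 4 (7)`: `ℓ mod 56 ∈ {15, 23, 39}` — part H
    have h56 : ℓ % 56 = 15 ∨ ℓ % 56 = 17 ∨ ℓ % 56 = 23 ∨ ℓ % 56 = 33 ∨ ℓ % 56 = 39 ∨ ℓ % 56 = 41 := by omega
    exact absurd h (sqrtNegThreePlusSqrtTwo_mk_prime_ne_splitDiscriminantClassCM_of_halfSplit hR ℓ hℓ h56 u hu)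

/-- **`[ℓ] ≠ [1]` for `E = ℚ(√-(3+√2))` and EVERY prime `ℓ ≡ 3 (mod 4)`** (`ℓ ≡ 3 (8)`: inert in `F`, and inert in
`E/F` or obstructed at `(σ)`; `ℓ ≡ 7 (8)`: half-split or obstructed at `(σ)`; `ℓ = 3, 7, 11, 19, 23, 31, 43, 47, …`).
[cite: Deligne1982HodgeCycles, §4 p. 30 (1) and Cor. 4.2] [cite: Landherr1936HermitianForms] -/
theorem sqrtNegThreePlusSqrtTwo_mk_prime_ne_splitDiscriminantClassCM_of_mod_four (ℓ : ℕ) (hℓ : ℓ.Prime)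
    (h4 : ℓ % 4 = 3) (u : (realField R)ˣ) (hu : (u : realField R) = ℓ) :
    (QuotientGroup.mk u : cmNormResidueGroup R) ≠ splitDiscriminantClassCM R 2 := by
  intro h
  rcases sqrtNegThreePlusSqrtTwo_splitType_of_mk_prime_eq_splitDiscriminantClassCM hR ℓ hℓ u hu h with
    h2 | ⟨h8, -⟩ | ⟨h8, -⟩ <;> omega

/-- **`[ℓ] ≠ [1]` for `E = ℚ(√-(3+√2))` and every prime `ℓ ≡ 3, 5, 6 (mod 7)` or `ℓ = 7`** — restated from the
classification (the tame place `(σ)`). [cite: Deligne1982HodgeCycles, §4 p. 30 (1) and Cor. 4.2] -/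
theorem sqrtNegThreePlusSqrtTwo_mk_prime_ne_splitDiscriminantClassCM_of_mod_seven (ℓ : ℕ) (hℓ : ℓ.Prime)
    (h7 : ℓ % 7 = 0 ∨ ℓ % 7 = 3 ∨ ℓ % 7 = 5 ∨ ℓ % 7 = 6) (u : (realField R)ˣ) (hu : (u : realField R) = ℓ) :
    (QuotientGroup.mk u : cmNormResidueGroup R) ≠ splitDiscriminantClassCM R 2 := by
  intro h
  rcases sqrtNegThreePlusSqrtTwo_splitType_of_mk_prime_eq_splitDiscriminantClassCM hR ℓ hℓ u hu h with
    h2 | ⟨-, h⟩ | ⟨-, h, -⟩ <;> omega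

/-! ### §3 The three split types beyond the census window: `53, 109` (`ℓ ≡ 5 (8)`), `137, 193` (`ℓ ≡ 1 (8)`), `149, 197` -/

/-- **`[53] = [1]`** (`53 ≡ 5 (8)`, `53 ≡ 4 (7)`): `53 = (12 + 3σ)² - σ(1 + σ)²`.
[cite: Deligne1982HodgeCycles, §4 p. 30 (1) and Cor. 4.2] -/
theorem sqrtNegThreePlusSqrtTwo_mk_53_eq_splitDiscriminantClassCM (u : (realField R)ˣ) (hu : (u : realField R) = 53) :
    (QuotientGroup.mk u : cmNormResidueGroup R) = splitDiscriminantClassCM R 2 :=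
  mk_eq_splitDiscriminantClassCM_two_of_coords_of_pos hR (by norm_num) (by norm_num) disc_not_sq_six_seven
    53 12 3 1 1 1 one_ne_zero (by norm_num) (by norm_num) u (by rw [hu]; norm_num)

/-- **`[109] = [1]`** (`109 ≡ 5 (8)`, `109 ≡ 4 (7)`): `109 = (12 + σ)² - σ(1 + σ)²`.
[cite: Deligne1982HodgeCycles, §4 p. 30 (1) and Cor. 4.2] -/
theorem sqrtNegThreePlusSqrtTwo_mk_109_eq_splitDiscriminantClassCM (u : (realField R)ˣ) (hu : (u : realField R) = 109) :
    (QuotientGroup.mk u : cmNormResidueGroup R) = splitDiscriminantClassCM R 2 :=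
  mk_eq_splitDiscriminantClassCM_two_of_coords_of_pos hR (by norm_num) (by norm_num) disc_not_sq_six_seven
    109 12 1 1 1 1 one_ne_zero (by norm_num) (by norm_num) u (by rw [hu]; norm_num)

/-- **`[137] = [1]`** — the FIRST prime of the third split type (`137 ≡ 1 (8)`, `137 ≡ 4 (7)`, `T⁴ + 6T² + 7` has the
root `36` mod `137`): `137 = (16 + 3σ)² - σ(1 - σ)²`. [cite: Deligne1982HodgeCycles, §4 p. 30 (1) and Cor. 4.2] -/
theorem sqrtNegThreePlusSqrtTwo_mk_137_eq_splitDiscriminantClassCM (u : (realField R)ˣ) (hu : (u : realField R) = 137) :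
    (QuotientGroup.mk u : cmNormResidueGroup R) = splitDiscriminantClassCM R 2 :=
  mk_eq_splitDiscriminantClassCM_two_of_coords_of_pos hR (by norm_num) (by norm_num) disc_not_sq_six_seven
    137 16 3 1 (-1) 1 one_ne_zero (by norm_num) (by norm_num) u (by rw [hu]; norm_num)

/-- **`[193] = [1]`** — the second prime of the third split type (`193 ≡ 1 (8)`, `193 ≡ 4 (7)`):
`193 = (12 + 3σ)² - σ(11 + σ)²`. [cite: Deligne1982HodgeCycles, §4 p. 30 (1) and Cor. 4.2] -/
theorem sqrtNegThreePlusSqrtTwo_mk_193_eq_splitDiscriminantClassCM (u : (realField R)ˣ) (hu : (u : realField R) = 193) :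
    (QuotientGroup.mk u : cmNormResidueGroup R) = splitDiscriminantClassCM R 2 :=
  mk_eq_splitDiscriminantClassCM_two_of_coords_of_pos hR (by norm_num) (by norm_num) disc_not_sq_six_seven
    193 12 3 11 1 1 one_ne_zero (by norm_num) (by norm_num) u (by rw [hu]; norm_num)

/-- **`[149] = [1]`** (`149 ≡ 5 (8)`, `149 ≡ 2 (7)`): `149 = (17 + 6σ)² - σ(14 + 4σ)²`.
[cite: Deligne1982HodgeCycles, §4 p. 30 (1) and Cor. 4.2] -/
theorem sqrtNegThreePlusSqrtTwo_mk_149_eq_splitDiscriminantClassCM (u : (realField R)ˣ) (hu : (u : realField R) = 149) :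
    (QuotientGroup.mk u : cmNormResidueGroup R) = splitDiscriminantClassCM R 2 :=
  mk_eq_splitDiscriminantClassCM_two_of_coords_of_pos hR (by norm_num) (by norm_num) disc_not_sq_six_seven
    149 17 6 14 4 1 one_ne_zero (by norm_num) (by norm_num) u (by rw [hu]; norm_num)

/-- **`[197] = [1]`** (`197 ≡ 5 (8)`, `197 ≡ 1 (7)`): `197 = (15 + 2σ)² - σ·6²`.
[cite: Deligne1982HodgeCycles, §4 p. 30 (1) and Cor. 4.2] -/
theorem sqrtNegThreePlusSqrtTwo_mk_197_eq_splitDiscriminantClassCM (u : (realField R)ˣ) (hu : (u : realField R) = 197) :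
    (QuotientGroup.mk u : cmNormResidueGroup R) = splitDiscriminantClassCM R 2 :=
  mk_eq_splitDiscriminantClassCM_two_of_coords_of_pos hR (by norm_num) (by norm_num) disc_not_sq_six_seven
    197 15 2 6 0 1 one_ne_zero (by norm_num) (by norm_num) u (by rw [hu]; norm_num)

end SqrtNegThreePlusSqrtTwo

/-! ### §4 Literal packaging (`R = S² + 6S + 7` verbatim) -/

/-- **The necessary half of the prime classification of the seventh census table, unconditionally**
(`R = S² + 6S + 7` literally, the field `Fact` discharged): for every prime `ℓ` with `[ℓ] = [1]` in
`F^×/Nm_{E/F}(E^×)`, `E = ℚ(√-(3+√2))`: `ℓ = 2`, or `ℓ ≡ 5 (mod 8)` and `ℓ ≡ 1, 2, 4 (mod 7)`, or `ℓ ≡ 1 (mod 8)`,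
`ℓ ≡ 1, 2, 4 (mod 7)` and `T⁴ + 6T² + 7` has a root mod `ℓ`. [cite: Deligne1982HodgeCycles, §4 p. 30 (1) and Cor. 4.2]
[cite: Landherr1936HermitianForms] -/
theorem sqrtNegThreePlusSqrtTwo_prime_splitType_necessary :
    haveI := fact_irreducible_realPolyQ_of_not_sq (R := X ^ 2 + C 6 * X + C 7) rfl disc_not_sq_six_seven
    ∀ ℓ : ℕ, ℓ.Prime → ∀ u : (realField (X ^ 2 + C 6 * X + C 7))ˣ, (u : realField (X ^ 2 + C 6 * X + C 7)) = ℓ →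
      (QuotientGroup.mk u : cmNormResidueGroup (X ^ 2 + C 6 * X + C 7)) =
        splitDiscriminantClassCM (X ^ 2 + C 6 * X + C 7) 2 →
      ℓ = 2 ∨ (ℓ % 8 = 5 ∧ (ℓ % 7 = 1 ∨ ℓ % 7 = 2 ∨ ℓ % 7 = 4)) ∨
        (ℓ % 8 = 1 ∧ (ℓ % 7 = 1 ∨ ℓ % 7 = 2 ∨ ℓ % 7 = 4) ∧ ∃ e : ZMod ℓ, e ^ 4 + 6 * e ^ 2 + 7 = 0) := by
  haveI := fact_irreducible_realPolyQ_of_not_sq (R := X ^ 2 + C 6 * X + C 7) rfl disc_not_sq_six_seven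
  exact fun ℓ hℓ u hu h =>
    sqrtNegThreePlusSqrtTwo_splitType_of_mk_prime_eq_splitDiscriminantClassCM rfl ℓ hℓ u hu h

/-- **`[ℓ] ≠ [1]` for every prime `ℓ ≡ 3 (mod 4)`, unconditionally** (`R = S² + 6S + 7` literally).
[cite: Deligne1982HodgeCycles, §4 p. 30 (1) and Cor. 4.2] -/
theorem sqrtNegThreePlusSqrtTwo_prime_mod_four_three_nonsplit :
    haveI := fact_irreducible_realPolyQ_of_not_sq (R := X ^ 2 + C 6 * X + C 7) rfl disc_not_sq_six_seven
    ∀ ℓ : ℕ, ℓ.Prime → ℓ % 4 = 3 →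
      ∀ u : (realField (X ^ 2 + C 6 * X + C 7))ˣ, (u : realField (X ^ 2 + C 6 * X + C 7)) = ℓ →
      (QuotientGroup.mk u : cmNormResidueGroup (X ^ 2 + C 6 * X + C 7)) ≠
        splitDiscriminantClassCM (X ^ 2 + C 6 * X + C 7) 2 := by
  haveI := fact_irreducible_realPolyQ_of_not_sq (R := X ^ 2 + C 6 * X + C 7) rfl disc_not_sq_six_seven
  exact fun ℓ hℓ h4 u hu => sqrtNegThreePlusSqrtTwo_mk_prime_ne_splitDiscriminantClassCM_of_mod_four rfl ℓ hℓ h4 u hu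

end Summit.HodgeConjecture.HodgeConjecture.Ring2.WeilCoverageCM

end
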